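import Mathlib
import Summits.Ventures.PercRepro2.AsymPins

/-!
# The weak (AS3) for nested pairs is a theorem, and (AS3) itself when `B □ B = A □ B`
(seat mine-b, cell pub-perc-repro2; conjectures/MINE-B.md §15.3)

For increasing events `A ⊆ B` on the cube `𝒫(U)` (`γ` blue, `ρ = U \ γ` red) the level-refined Reimer
statement (AS3) (`StepZeroOfAS3.lean`) reads `#{A □ B at γ ∧ ρ ∉ B} ≤ #{γ ∈ A ∧ ρ ∈ B ∧ ¬ B □ B at ρ}`.
Replacing the exclusion `¬ B □ B at ρ` by the weaker `¬ A □ B at ρ` gives a statement that FOLLOWS from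
Reimer's inequality for increasing events in two lines:

* `AS3_weak_of_nested` — `#{A □ B at γ ∧ ρ ∉ B} ≤ #{γ ∈ A ∧ ρ ∈ B ∧ ¬ A □ B at ρ}` for `A ⊆ B`:
  Reimer for `(A, B)` split by `ρ ∈ B` on the left and by `A □ B at ρ` on the right, and the colour swap
  `#{γ ∈ A ∧ A □ B at ρ} = #{A □ B at γ ∧ ρ ∈ A} ≤ #{A □ B at γ ∧ ρ ∈ B}`;
* `AS3_of_nested_dOcc_eq` — hence (AS3) holds for every nested pair with `B □ B = A □ B` on the red
  sides, and in particular (`AS3_of_nested_one_generator`) when `B` is `A` with ONE extra generator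
  `K` (`B X ↔ A X ∨ K ⊆ X`): of two disjoint `B`-witnesses at most one contains `K`, so the other is an
  `A`-witness and the pair is an `(A, B)`-occurrence.

In the bookkeeping of MINE-B.md §15.3 this is «Reimer ⟺ |L| + |S| ≤ |T|» together with `|S| ≥ 0`; the
conjecture (AS3) is «|L| + |G| ≤ |T|», and the two coincide exactly when the gap set `G` (red has two
disjoint `B`-witnesses but no `A`-witness disjoint from a `B`-witness) is empty.
-/

open Finset

namespace Summit.Ventures.PercRepro2

namespace StepZero

open ReimerCube

variable {E : Type*} [DecidableEq E]

open Classical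

/-- **The weak (AS3) for nested pairs** (MINE-B.md §15.3, statement (T)): for increasing `A ⊆ B`,
`#{γ ⊆ U : A □ B at γ ∧ U \ γ ∉ B} ≤ #{γ ⊆ U : A γ ∧ B (U \ γ) ∧ ¬ A □ B at U \ γ}`. -/
theorem AS3_weak_of_nested (U : Finset E) {A B : Finset E → Prop} (hA : Incr A) (hB : Incr B)
    (hAB : ∀ X, A X → B X) :
    (U.powerset.filter (fun γ => DOcc A B γ ∧ ¬ B (U \ γ))).card
      ≤ (U.powerset.filter (fun γ => A γ ∧ B (U \ γ) ∧ ¬ DOcc A B (U \ γ))).card := by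
  have hR := reimer_increasing U A B hA hB
  -- split Reimer's sources by `ρ ∈ B`
  have s1 := Finset.card_filter_add_card_filter_not (fun γ => B (U \ γ))
    (s := U.powerset.filter (fun γ => DOcc A B γ))
  rw [Finset.filter_filter, Finset.filter_filter] at s1
  -- split Reimer's targets by `A □ B at ρ`
  have s2 := Finset.card_filter_add_card_filter_not (fun γ => DOcc A B (U \ γ))
    (s := U.powerset.filter (fun γ => A γ ∧ B (U \ γ)))
  rw [Finset.filter_filter, Finset.filter_filter] at s2
  -- the targets carrying `A □ B` on the red side: `B ρ` is implied
  have e1 : (U.powerset.filter (fun γ => (A γ ∧ B (U \ γ)) ∧ DOcc A B (U \ γ))).card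
      = (U.powerset.filter (fun γ => A γ ∧ DOcc A B (U \ γ))).card := by
    apply congrArg Finset.card
    apply Finset.filter_congr
    intro γ _
    constructor
    · rintro ⟨⟨h1, -⟩, h2⟩; exact ⟨h1, h2⟩
    · rintro ⟨h1, h2⟩; exact ⟨⟨h1, (A_and_B_of_dOcc h2).2⟩, h2⟩
  -- the colour swap
  have e2 : (U.powerset.filter (fun γ => A γ ∧ DOcc A B (U \ γ))).card
      = (U.powerset.filter (fun γ => DOcc A B γ ∧ A (U \ γ))).card :=
    card_filter_swap A (fun X => DOcc A B X) U
  -- `ρ ∈ A` implies `ρ ∈ B`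
  have e3 : (U.powerset.filter (fun γ => DOcc A B γ ∧ A (U \ γ))).card
      ≤ (U.powerset.filter (fun γ => DOcc A B γ ∧ B (U \ γ))).card := by
    apply Finset.card_le_card
    intro γ hγ
    rw [Finset.mem_filter] at hγ ⊢
    exact ⟨hγ.1, hγ.2.1, hAB _ hγ.2.2⟩
  -- the target form
  have e4 : (U.powerset.filter (fun γ => (A γ ∧ B (U \ γ)) ∧ ¬ DOcc A B (U \ γ))).card
      = (U.powerset.filter (fun γ => A γ ∧ B (U \ γ) ∧ ¬ DOcc A B (U \ γ))).card := by
    apply congrArg Finset.card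
    apply Finset.filter_congr
    intro γ _
    exact and_assoc
  omega

/-- **(AS3) for nested pairs whose red-side `B □ B` is `A □ B`**: if every configuration
`ρ ⊆ U` with two disjoint `B`-witnesses carries an `A`-witness disjoint from a `B`-witness, then
`AS3 U A B`. -/
theorem AS3_of_nested_dOcc_eq (U : Finset E) {A B : Finset E → Prop} (hA : Incr A) (hB : Incr B)
    (hAB : ∀ X, A X → B X) (hBB : ∀ ρ ⊆ U, DOcc B B ρ → DOcc A B ρ) : AS3 U A B := by
  unfold AS3
  refine le_trans (AS3_weak_of_nested U hA hB hAB) ?_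
  apply Finset.card_le_card
  intro γ hγ
  rw [Finset.mem_filter, Finset.mem_powerset] at hγ ⊢
  refine ⟨hγ.1, hγ.2.1, hγ.2.2.1, fun h => hγ.2.2.2 (hBB _ Finset.sdiff_subset h)⟩

/-- the event `A` enlarged by one generator `K` -/
def addGen (A : Finset E → Prop) (K : Finset E) : Finset E → Prop := fun X => A X ∨ K ⊆ X

omit [DecidableEq E] in
/-- `addGen A K` is increasing -/
lemma incr_addGen {A : Finset E → Prop} (hA : Incr A) (K : Finset E) : Incr (addGen A K) := by
  intro S T hST h
  rcases h with h | h
  · exact Or.inl (hA hST h)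
  · exact Or.inr (h.trans hST)

omit [DecidableEq E] in
/-- two disjoint witnesses of `addGen A K` cannot both contain the nonempty `K`, so one of them is an
`A`-witness: `(addGen A K) □ (addGen A K)` at `ρ` gives `A □ (addGen A K)` at `ρ`. -/
lemma dOcc_addGen_of_dOcc_self {A : Finset E → Prop} (hA : Incr A) (K : Finset E) (hK : K.Nonempty)
    {ρ : Finset E} (h : DOcc (addGen A K) (addGen A K) ρ) : DOcc A (addGen A K) ρ := by
  obtain ⟨K₁, L₁, hK₁, hL₁, hd, h₁, h₂⟩ := h
  rcases h₁ K₁ le_rfl with hw₁ | hw₁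
  · exact ⟨K₁, L₁, hK₁, hL₁, hd, fun T hT => hA hT hw₁, h₂⟩
  · rcases h₂ L₁ le_rfl with hw₂ | hw₂
    · exact ⟨L₁, K₁, hL₁, hK₁, hd.symm, fun T hT => hA hT hw₂, h₁⟩
    · exfalso
      obtain ⟨x, hx⟩ := hK
      exact Finset.disjoint_left.mp hd (hw₁ hx) (hw₂ hx)

/-- **(AS3) when `B` is `A` with one extra generator** (the «one member through `q`» case of the
(RS) form, MINE-B.md §14 / §15.3): `AS3 U A (addGen A K)` for every increasing `A` and every `K`. -/
theorem AS3_of_nested_one_generator (U : Finset E) {A : Finset E → Prop} (hA : Incr A)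
    (K : Finset E) : AS3 U A (addGen A K) := by
  rcases K.eq_empty_or_nonempty with hK | hK
  · -- `K = ∅`: `addGen A K` is everything, there is no source
    subst hK
    unfold AS3
    have h0 : (U.powerset.filter (fun γ => DOcc A (addGen A ∅) γ ∧ ¬ addGen A ∅ (U \ γ))).card = 0 := by
      rw [Finset.card_eq_zero, Finset.filter_eq_empty_iff]
      intro γ _ h
      exact h.2 (Or.inr (Finset.empty_subset _))
    rw [h0]
    exact Nat.zero_le _
  · exact AS3_of_nested_dOcc_eq U hA (incr_addGen hA K) (fun _ h => Or.inl h)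
      (fun _ _ h => dOcc_addGen_of_dOcc_self hA K hK h)

end StepZero

end Summit.Ventures.PercRepro2
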